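/-
Copyright (c) 2026 the pub-hodgecm-mathlib formalisation cell (harness21).  Prover seat hodgecm-mathlib-K2E3-p37 (g3): Track B «K2-LIT»,
hLiu418 = stmt-HodgeConjecture-24832; LEAD F0P6-plan (g14) BATCH #149 (2) «(K1a-2d) ED. 2» (line lead K2E5-p16 (g8)), sibling (A′) of the CM edition:
the TWISTED twin of ★ (F-GK-3) FILE B `K2LiuSiegelCocycleSphericalLocalInt` (K2Liu-p27 (g0)).
-/
import Summits.HodgeConjecture.HodgeConjecture.Theorems.K2LiuRankOneSingularLocalValue         -- ★ p862724 (K1a-2b): the twisted cocycle, non-split, raw (K2E5-p16 (g8))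
import Summits.HodgeConjecture.HodgeConjecture.Theorems.K2LiuRankOneSingularLocalValueSplit    -- ★ (K1a-2c): the twisted cocycle, split, raw (F0P2-p09 (g2))
import Summits.HodgeConjecture.HodgeConjecture.Theorems.K2LiuRankOneWhittakerPolynomialSigned  -- ★ p862774 (LH7-p06 (g2)): the `htw` discharger (signed Whittaker polynomial)
import Summits.HodgeConjecture.HodgeConjecture.Theorems.K2LiuSiegelCocycleSphericalLocalInt     -- ★ (F-GK-3) FILE B (+ part 1 letters ∕ box, ★ FILE A unit scalars)
import Summits.HodgeConjecture.HodgeConjecture.Theorems.K2LiuGKRankOneIdentityLFactor          -- ★ `isUnramifiedChar_chiF`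
import HarnessLib

/-!
# Crux `HLiu418`, road `K2_Liu`, socket #41 KIND 1 a♮, organ (K1a-GK), file (K1a-2) sibling (A′):
# THE TWISTED SIEGEL INTEGRAL `∫_{N_Δ(F_v)} ψ(b₁(u)·τ) φ°(w_Δ u) dνN(u)` OF THE SPHERICAL SECTION AT A GOOD PLACE — `vol · [L_F(2s+1)∕L_F(2s+2)] · [L_{E∕F}(2s)∕L_{E∕F}(2s+1)] · L_F(2s)⁻¹ · Σ_{k ≤ ord τ} (α_F q^{1−2s})^k`

Cell `hodgecm-mathlib`, crux item hLiu418 = `stmt-HodgeConjecture-24832`; squad K2 ∕ K2Liu; prover K2E3-p37 (g3) (W4 valve hand of LEAD F0P6-plan (g14), BATCH #149 (2));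
line lead K2E5-p16 (g8) (census `CENSUS-K1a-GK` §1 ∕ §3 (K1a-2)).  THEOREMS ONLY (no `def`, no instance, no notation, no named-fact hypothesis, no `sorry`); lane
`--supports stmt-HodgeConjecture-24832 --as helper` (count-neutral helper).  ONE FRAME (RULING M-156o (c)): `φ := frameConj Q ∘ toLocalFour`; the adapted-frame data
`(D, D⁻¹, Q)` are hypotheses, as in ★ B7 ∕ ★ (F-GK-2) ∕ ★ FILE A ∕ ★ FILE B (the CM consumer takes them from ★ `K2LiuRankOneCornerCharacterReading.exists_adaptedFrame_eq`).

THE POINT ([KudlaRallis1994, §2], [Shimura1997, §18.4], [Casselman1980, §3 Thm. 3.1], [Tate1950, §2.5]).  ★ p862724 (K1a-2b) evaluates the TWISTED Siegel integral of a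
`K₀`-spherical section by the cocycle `A₂ A₁ A₂`, hypothesis-first on the twisted rank-one stage `htw` and with the four unit scalars of the cocycle (`χ_s(m₀)`, `C₁`,
`χ_w(−1)`, `C₃·∏‖δ_w‖`) left symbolic; ★ p862774 (LH7-p06) IS the `htw` letter (Tate's shells against `ψ(xτ)`, `ψ` of conductor `𝒪_v`, `ord τ = M`).  This file is the
twisted twin of ★ FILE B: at a GOOD place (`|2|_w = |δ|_w = 1`, `χ_w` unramified and unitary, the frame `D`, `D⁻¹` integral at every `w ∣ v`) and on the SPHERICAL section
`φ°` (★ D10 `IsSphericalSection`: right `K_v = H(𝒪_v)`-invariant, `φ°(1) = 1`) every letter is paid BY NAME — `K₀ := K_v` (letters ★ FILE B part 1 §2, box ★ part 1 §3),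
unit scalars ★ FILE A §2, `htw` ★ p862774 §3 at `C₀ := C₃·∏‖δ_w‖ = 1` — and the three stage factors collapse (★ F-GK-1 `one_add_eq_lFactor_div_lFactor`, ★ LH7-p06
`one_sub_mul_sum_sub_one_eq`) to ★ T1 letters:
  **`∫ ψ((e⁻¹u)₁·τ) φ°(w_Δ u) dνN(u) = νN{u | ↑u ∈ K_v} · [lF(2s+1)∕lF(2s+2)] · [lEN(2s)∕lEN(2s+1)] · lF(2s)⁻¹ · Σ_{k ≤ M} (unramValue χ_F · q_v^{1−2s})^k`**
(`lF(z) = L_F(z, χ_{F,v})`, `lEN(z) = Π_{w∣v} L_{E_w}(z, χ∘N)`): the first two reflections of the untwisted Gindikin–Karpelevich value (★ FILE B: all three) times the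
ε-signed rank-one Whittaker polynomial `b_v⁻¹·P°_v(τ)` of the innermost letter.
* §1 `integral_addChar_mul_weylDelta_eq_of_isSphericalSection_of_forall_eq` — non-split `v` (★ p862724).
* §2 `integral_addChar_mul_weylDelta_eq_of_isSphericalSection_of_pair` — split `v` (★ (K1a-2c)).
* §3 `integral_addChar_mul_weylDelta_eq_of_isSphericalSection` (both, ★ `placesOver_cases'`) and `…_of_isGoodPlace` (★ Lit `LocalSplitting.IsGoodPlace`, whose field `psi`
  supplies the conductor of `ψ_v = adeleAddCharAt F v`) — the `hGK` letter of ★ p862811 (K1a-2d) ED. 1 §2∕§3 at `R vol := vol · (…)`, for the generic datum.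
HONEST LABEL.  `HC_CM` is proved only modulo the 7 printed citations (2 remaining named inputs: hLiu418 = `stmt-HodgeConjecture-24832`,
h413 = `stmt-HodgeConjecture-24833`) until rung 0 closes.  Count-neutral helper; closes no socket.

## References
* [Casselman1980] W. Casselman, *The unramified principal series of p-adic groups I*, Compositio Math. 40 (1980), §3 Thm. 3.1 (the cocycle `s₂ s₁ s₂`, `T_w φ_K = c_w φ_K`).
* [KudlaRallis1994] S. Kudla, S. Rallis, *A regularized Siegel–Weil formula: the first term identity*, Ann. of Math. 140 (1994), §2 (singular coefficients via `i* ∘ U(s)`).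
* [Shimura1997] G. Shimura, *Euler Products and Eisenstein Series*, CBMS 93 (1997), §18.4–18.5 (singular series of rank `r`).
* [Tate1950] J. Tate, *Fourier analysis in number fields and Hecke's zeta-functions* (1950), §2.5, in Cassels–Fröhlich (1967) Ch. XV.
* [HarrisKudlaSweet1996] M. Harris, S. Kudla, W. J. Sweet, J. AMS 9 (1996), §6 (6.14)–(6.16).
* [GelbartRogawski1991] S. Gelbart, J. Rogawski, Invent. Math. 105 (1991), §3.1 (3.1.3) (the good places of the doubled unitary datum).
* [GanQiuTakeda2014] W. T. Gan, Y. Qiu, S. Takeda, Invent. Math. 198 (2014), §6.4 Prop. 15.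
-/

set_option autoImplicit false
set_option linter.dupNamespace false -- the mandated namespace repeats `HodgeConjecture.HodgeConjecture`

noncomputable section

open scoped Classical NNReal ENNReal
open NumberField IsDedekindDomain Matrix MeasureTheory Topology
open Literature.NumberTheory.GaloisRepresentations.IsNonarchimedeanLocalField
open Literature.NumberTheory.Automorphic Literature.NumberTheory.Automorphic.UnitaryGroup
open Literature.NumberTheory.GelbartRogawski1991.AdaptedBlocks
open Literature.NumberTheory.GelbartRogawski1991.UnitaryDualPair.LocalSplitting
open Literature.NumberTheory.K2Lit.LocalSiegelDoubled
open Summit.HodgeConjecture.HodgeConjecture.Cruxes.HLiu418.K2LiuQRationalDefs Summit.HodgeConjecture.HodgeConjecture.Cruxes.HLiu418.K2LiuQRationalLFactor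
open Summit.HodgeConjecture.HodgeConjecture.Cruxes.HLiu418.K2LiuLocalLFactorDefs
open Summit.HodgeConjecture.HodgeConjecture.Cruxes.HLiu418.K2LiuLocalSiegelIwasawaFrame Summit.HodgeConjecture.HodgeConjecture.Cruxes.HLiu418.K2LiuLocalSiegelIwasawa
open Summit.HodgeConjecture.HodgeConjecture.Cruxes.HLiu418.K2LiuDoubledUTwoTwoBorelFrame Summit.HodgeConjecture.HodgeConjecture.Cruxes.HLiu418.K2LiuDoubledUTwoTwoWeylCocycle
open Summit.HodgeConjecture.HodgeConjecture.Cruxes.HLiu418.K2LiuDoubledUTwoTwoLevi Summit.HodgeConjecture.HodgeConjecture.Cruxes.HLiu418.K2LiuDoubledUTwoTwoFrameTransport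
open Summit.HodgeConjecture.HodgeConjecture.Cruxes.HLiu418.K2LiuUnipDeltaRankOneCoordinates Summit.HodgeConjecture.HodgeConjecture.Cruxes.HLiu418.K2LiuSiegelCocycleLetters
open Summit.HodgeConjecture.HodgeConjecture.Cruxes.HLiu418.K2LiuSiegelIntertwiningCocycle Summit.HodgeConjecture.HodgeConjecture.Cruxes.HLiu418.K2LiuLocalRingPlaceDecomposition
open Summit.HodgeConjecture.HodgeConjecture.Cruxes.HLiu418.K2LiuA7NormalisedRegularitySetup
open Summit.HodgeConjecture.HodgeConjecture.Cruxes.HLiu418.K2LiuRankOneSphericalStage (one_add_eq_lFactor_div_lFactor)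
open Summit.HodgeConjecture.HodgeConjecture.Cruxes.HLiu418.K2LiuSiegelCocycleSphericalValueNormalised
open Summit.HodgeConjecture.HodgeConjecture.Cruxes.HLiu418.K2LiuSiegelCocycleLettersLocalInt
open Summit.HodgeConjecture.HodgeConjecture.Cruxes.HLiu418.K2LiuRankOneWhittakerPolynomialSigned (integrable_and_integral_addChar_mul_apply_eq
  one_sub_mul_sum_sub_one_eq mul_cpow_neg_eq)
open Summit.HodgeConjecture.HodgeConjecture.Cruxes.HLiu418.K2LiuGKRankOneIdentityLFactor (isUnramifiedChar_chiF)

namespace Summit.HodgeConjecture.HodgeConjecture.Cruxes.HLiu418.K2LiuRankOneSingularLocalValueGoodPlace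

variable (F : Type) [Field F] [NumberField F] (E : Type) [Field E] [NumberField E] [Algebra F E]
  [Algebra.IsQuadraticExtension F E] (c : E ≃ₐ[F] E)
  {δ : E} (hcδ : c δ = -δ) (hδ : δ ≠ 0) {d : F} (hd : δ * δ = algebraMap F E d) (v : HeightOneSpectrum (𝓞 F))
  {T₂ : Matrix (Fin 2) (Fin 2) F} (hT₂ : T₂.IsSymm) {J₂D : Matrix (Fin (2 + 2)) (Fin (2 + 2)) E} (hJ₂D : J₂D = (gramD F 2 T₂).map (algebraMap F E))
  (D Dinv : Matrix (Fin 2) (Fin 2) F) (hDD : D * Dinv = 1) (hDD' : Dinv * D = 1) (Q : GL (Fin (2 + 2)) F)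
  (hQm : (Q : Matrix (Fin (2 + 2)) (Fin (2 + 2)) F) = Matrix.reindex (e₂ 2) (e₂ 2) (Matrix.fromBlocks 1 D 1 (-D)))
  (hQ : (Q : Matrix (Fin (2 + 2)) (Fin (2 + 2)) F)ᵀ * gramD F 2 T₂ * (Q : Matrix (Fin (2 + 2)) (Fin (2 + 2)) F) = (StdForm.antidiagonal (2 + 2)).over F)
  (h2 : ∀ w : PlacesOver E v, ValuativeRel.valuation (w.1.adicCompletion E) (2 : w.1.adicCompletion E) = 1)
  (hδv : ∀ w : PlacesOver E v, ValuativeRel.valuation (w.1.adicCompletion E) (algebraMap E (w.1.adicCompletion E) δ) = 1)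
  (hDw : ∀ (w : PlacesOver E v) (i j : Fin 2), ValuativeRel.valuation (w.1.adicCompletion E) (algebraMap E (w.1.adicCompletion E) (algebraMap F E (D i j))) ≤ 1)
  (hDiw : ∀ (w : PlacesOver E v) (i j : Fin 2), ValuativeRel.valuation (w.1.adicCompletion E) (algebraMap E (w.1.adicCompletion E) (algebraMap F E (Dinv i j))) ≤ 1)
  [MeasurableSpace (unipDeltaLocal F E c v 2 (JD := J₂D))] [BorelSpace (unipDeltaLocal F E c v 2 (JD := J₂D))]
  (e : (v.adicCompletion F × UnitaryGroup.LocalRing E v × v.adicCompletion F) ≃ₜ unipDeltaLocal F E c v 2 (JD := J₂D))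
  (he : ∀ b₁ z b₂, ((e (b₁, z, b₂) : unipDeltaLocal F E c v 2 (JD := J₂D)) : UnitaryGroup.localPi E c (2 + 2) J₂D v) = FrameTransport.frameConj F E c v (2 + 2) hJ₂D (antidiagonal_over_eq_map F E 2) Q hQ (toLocalFour F E c v (nSiegel (UnitaryGroup.LocalRing E v) (UnitaryGroup.conjLocal E c v) (UnitaryGroup.conjLocal_conjLocal c v hcδ hδ) (UnitaryGroup.toLocalRing E v b₁ * algebraMap E (UnitaryGroup.LocalRing E v) δ) (z) (UnitaryGroup.toLocalRing E v b₂ * algebraMap E (UnitaryGroup.LocalRing E v) δ) (conjLocal_coord F E c hcδ v b₁) (conjLocal_coord F E c hcδ v b₂))))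
  (headd : ∀ p p', e (p + p') = e p * e p')
  (νN : Measure (unipDeltaLocal F E c v 2 (JD := J₂D))) [νN.IsHaarMeasure]
  (χv : ∀ w : PlacesOver E v, (w.1.adicCompletion E)ˣ →* ℂˣ)
  (hχu : ∀ (w' : PlacesOver E v) (x : (w'.1.adicCompletion E)ˣ), ‖((χv w' x : ℂˣ) : ℂ)‖ = 1)
  (hχ : ∀ (w : PlacesOver E v) (u : (w.1.adicCompletion E)ˣ), ValuativeRel.valuation (w.1.adicCompletion E) (u : w.1.adicCompletion E) = 1 → χv w u = 1)
  {ψ : AddChar (v.adicCompletion F) Circle} (hψ : Continuous ψ) (h0 : ψ.HasConductorExp 0)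
  {τ : v.adicCompletion F} {M : ℕ} (hM : τ ∈ primePowBall (v.adicCompletion F) M) (hM' : τ ∉ primePowBall (v.adicCompletion F) (M + 1))

/-! ## §0 The twisted stage scalar in ★ T1 letters: `1 + (Σ_{k<M}X^{k+1} − q⁻¹Σ_{k≤M}X^{k+1}) = L(2s, χ_F)⁻¹ · Σ_{k≤M} X^k` -/

/-- **the signed Whittaker polynomial in `L`-factor currency**: `1 + (Σ_{k<M} X^{k+1} − q⁻¹ Σ_{k≤M} X^{k+1}) = L_F(z, ν)⁻¹ · Σ_{k≤M} X^k` for `X = unramValue ν · q^{1−z}`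
(★ LH7-p06 `one_sub_mul_sum_sub_one_eq` + `mul_cpow_neg_eq`, ★ T1 `lFactor_def`). [cite: Casselman1980, §3 Thm. 3.1] [cite: Tate1950, §2.5] -/
theorem one_add_shellSum_eq_lFactor_inv_mul_sum (ν : (v.adicCompletion F)ˣ →* ℂˣ) (z : ℂ) (M₀ : ℕ) :
    1 + ((∑ k ∈ Finset.range M₀, (unramValue F v ν * (residueFieldCard (v.adicCompletion F) : ℂ) ^ (1 - z)) ^ (k + 1)) -
        (residueFieldCard (v.adicCompletion F) : ℂ)⁻¹ *
          ∑ k ∈ Finset.range (M₀ + 1), (unramValue F v ν * (residueFieldCard (v.adicCompletion F) : ℂ) ^ (1 - z)) ^ (k + 1)) =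
      (lFactor F v ν z)⁻¹ * ∑ k ∈ Finset.range (M₀ + 1), (unramValue F v ν * (residueFieldCard (v.adicCompletion F) : ℂ) ^ (1 - z)) ^ k := by
  rw [← one_sub_mul_sum_sub_one_eq, lFactor_def, inv_inv, (mul_cpow_neg_eq (F := v.adicCompletion F) (unramValue F v ν) z).1]
  ring

/-! ## §1 Non-split place -/

include hd hT₂ hDD hDD' hQm he headd h2 hδv hDw hDiw hχu hχ hψ h0 hM hM' in
set_option maxHeartbeats 400000 in -- as ★ p862724 §1 ∕ ★ FILE A §3 (the binder telescope of the chain; `whnf` > 200 000): structural `rw`∕`exact` only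
/-- **THE TWISTED SIEGEL INTEGRAL OF THE SPHERICAL SECTION, NON-SPLIT GOOD PLACE.**  `w` the only place of `E` above `v`; `|2|_w = |δ|_w = 1`, `χ_w` unramified and
unitary, the frame `D`, `D⁻¹` integral at `w`; `e` the cocycle coordinates of `N_Δ(F_v)` (★ B1b-2b ∕ ★ B4d-3), `ψ` a continuous additive character of `F_v` of conductor
`𝒪_v`, `τ ∈ 𝔭^M ∖ 𝔭^{M+1}`.  Then for every spherical section `φ°` of `I_v(s, χ_v)`, `1 < re s`, and every Haar `νN` on `N_Δ(F_v)`: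
**`∫ ψ((e⁻¹u)₁·τ) φ°(w_Δ u) dνN(u) = νN{u | ↑u ∈ K_v} · [lF(2s+1)∕lF(2s+2)] · [lEN(2s)∕lEN(2s+1)] · lF(2s)⁻¹ · Σ_{k≤M} (unramValue χ_F · q_v^{1−2s})^k`**
(★ p862724 at `K₀ := K_v`, `h := 1`; letters ★ FILE B part 1 §2; box ★ part 1 §3; `χ_s(m₀) = C₁ = χ_w(−1) = C₃∏‖δ_w‖ = 1` ★ FILE A §2; `htw` ★ p862774 §3; `φ°(1) = 1`).
[cite: Casselman1980, §3 Thm. 3.1] [cite: KudlaRallis1994, §2] [cite: Shimura1997, §18.4] [cite: Tate1950, §2.5] [cite: HarrisKudlaSweet1996, §6 (6.14)–(6.16)] -/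
theorem integral_addChar_mul_weylDelta_eq_of_isSphericalSection_of_forall_eq
    {s : ℂ} (hs : 1 < s.re) {f : UnitaryGroup.localPi E c (2 + 2) J₂D v → ℂ} (hf : IsSphericalSection F E c hcδ hδ hd v 2 hT₂ hJ₂D χv s f)
    (w : PlacesOver E v) (hw : ∀ w' : PlacesOver E v, w' = w) :
    ∫ u, (((ψ ((e.symm u).1 * τ) : Circle) : ℂ)) * f (weylDelta F E c v 2 hJ₂D (T₀ := T₂) * (u : UnitaryGroup.localPi E c (2 + 2) J₂D v)) ∂νN =
      (νN.real {u : unipDeltaLocal F E c v 2 (JD := J₂D) | (u : UnitaryGroup.localPi E c (2 + 2) J₂D v) ∈ UnitaryGroup.localInt E c (2 + 2) J₂D v} : ℂ) *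
        ((lF F E v χv (2 * s + 1) / lF F E v χv (2 * s + 2)) * (lEN F E c v χv (2 * s) / lEN F E c v χv (2 * s + 1)) *
          ((lF F E v χv (2 * s))⁻¹ *
            ∑ k ∈ Finset.range (M + 1), (unramValue F v (chiF F E v χv) * (residueFieldCard (v.adicCompletion F) : ℂ) ^ (1 - 2 * s)) ^ k)) := by
  borelize (v.adicCompletion F)
  obtain ⟨μF, hμF⟩ : ∃ μ : Measure (v.adicCompletion F), μ.IsAddHaarMeasure := ⟨Measure.addHaar, inferInstance⟩
  obtain ⟨A, hA⟩ := exists_partialWeylGL F E v w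
  have hfK : ∀ g, ∀ k ∈ UnitaryGroup.localInt E c (2 + 2) J₂D v, f (g * k) = f g := fun g k hk => hf.apply_mul_of_mem_localInt hk g
  have hχ' : ∀ (w' : PlacesOver E v) (u : (w'.1.adicCompletion E)ˣ), Valued.v (u : w'.1.adicCompletion E) = 1 → χv w' u = 1 :=
    fun w' u hu => hχ w' u ((valuation_eq_one_iff_valued E w'.1 _).2 hu)
  have heC : 1 < (2 * s).re := by simp; linarith
  -- the letters of `K_v` at integral points (★ FILE B part 1 §2)
  have hKw₂ := frameConj_weylTwo_mem_localInt F E c v hJ₂D D Dinv hDD Q hQm hQ h2 hDw hDiw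
  have hKu : ∀ t ∈ primePowBall (v.adicCompletion F) 0, FrameTransport.frameConj F E c v (2 + 2) hJ₂D (antidiagonal_over_eq_map F E 2) Q hQ (toLocalFour F E c v (uLongTwo (UnitaryGroup.LocalRing E v) (UnitaryGroup.conjLocal E c v) (UnitaryGroup.toLocalRing E v t * algebraMap E (UnitaryGroup.LocalRing E v) δ) (conjLocal_coord F E c hcδ v t))) ∈ UnitaryGroup.localInt E c (2 + 2) J₂D v :=
    fun t ht => frameConj_uLongTwo_coord_mem_localInt F E c hcδ v hJ₂D D Dinv hDD Q hQm hQ h2 hδv hDw hDiw t ht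
  have hKū : ∀ t ∈ primePowBall (v.adicCompletion F) 0, FrameTransport.frameConj F E c v (2 + 2) hJ₂D (antidiagonal_over_eq_map F E 2) Q hQ (toLocalFour F E c v (uLongTwo (UnitaryGroup.LocalRing E v) (UnitaryGroup.conjLocal E c v) (UnitaryGroup.toLocalRing E v t * algebraMap E (UnitaryGroup.LocalRing E v) δ⁻¹) (conjLocal_coord_inv F E c hcδ v t))) ∈ UnitaryGroup.localInt E c (2 + 2) J₂D v :=
    fun t ht => frameConj_uLongTwo_coord_inv_mem_localInt F E c hcδ v hJ₂D D Dinv hDD Q hQm hQ h2 hδv hDw hDiw t ht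
  -- the twisted rank-one stage `htw` (★ p862774 §3 at `C₀ := χ_s(φ t(−δ⁻¹,1))·∏‖δ_w‖`, `ν := χ_F`, `e := 2s`, `y := 1`)
  have htw : ∀ Φ : UnitaryGroup.localPi E c (2 + 2) J₂D v → ℂ, (∀ g, ∀ k ∈ UnitaryGroup.localInt E c (2 + 2) J₂D v, Φ (g * k) = Φ g) →
      (∀ (x : (v.adicCompletion F)ˣ) (g : UnitaryGroup.localPi E c (2 + 2) J₂D v),
        Φ (FrameTransport.frameConj F E c v (2 + 2) hJ₂D (antidiagonal_over_eq_map F E 2) Q hQ (toLocalFour F E c v (weylTwo (UnitaryGroup.LocalRing E v) (UnitaryGroup.conjLocal E c v))) * FrameTransport.frameConj F E c v (2 + 2) hJ₂D (antidiagonal_over_eq_map F E 2) Q hQ (toLocalFour F E c v (uLongTwo (UnitaryGroup.LocalRing E v) (UnitaryGroup.conjLocal E c v) (UnitaryGroup.toLocalRing E v (x : v.adicCompletion F) * algebraMap E (UnitaryGroup.LocalRing E v) δ) (conjLocal_coord F E c hcδ v (x : v.adicCompletion F)))) * g) =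
          (localSiegelCharacter F E c v 2 χv s (FrameTransport.frameConj F E c v (2 + 2) hJ₂D (antidiagonal_over_eq_map F E 2) Q hQ (toLocalFour F E c v (torusElt (UnitaryGroup.LocalRing E v) (UnitaryGroup.conjLocal E c v) (UnitaryGroup.conjLocal_conjLocal c v hcδ hδ) (-((Units.mk0 δ hδ).map (algebraMap E (UnitaryGroup.LocalRing E v) : E →* UnitaryGroup.LocalRing E v))⁻¹) (1)))) * ((∏ w' : PlacesOver E v, ‖algebraMap E (UnitaryGroup.LocalRing E v) δ w'‖ : ℝ) : ℂ)) * ((((chiF F E v χv) x)⁻¹ : ℂˣ) : ℂ) * ((normAbs (v.adicCompletion F) (x : v.adicCompletion F) : ℝ) : ℂ) ^ (-(2 * s)) *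
            Φ (FrameTransport.frameConj F E c v (2 + 2) hJ₂D (antidiagonal_over_eq_map F E 2) Q hQ (toLocalFour F E c v (weylTwo (UnitaryGroup.LocalRing E v) (UnitaryGroup.conjLocal E c v))) * FrameTransport.frameConj F E c v (2 + 2) hJ₂D (antidiagonal_over_eq_map F E 2) Q hQ (toLocalFour F E c v (uLongTwo (UnitaryGroup.LocalRing E v) (UnitaryGroup.conjLocal E c v) (UnitaryGroup.toLocalRing E v ((x⁻¹ : (v.adicCompletion F)ˣ) : v.adicCompletion F) * algebraMap E (UnitaryGroup.LocalRing E v) δ⁻¹) (conjLocal_coord_inv F E c hcδ v ((x⁻¹ : (v.adicCompletion F)ˣ) : v.adicCompletion F)))) * FrameTransport.frameConj F E c v (2 + 2) hJ₂D (antidiagonal_over_eq_map F E 2) Q hQ (toLocalFour F E c v (weylTwo (UnitaryGroup.LocalRing E v) (UnitaryGroup.conjLocal E c v))) * g)) →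
      Φ (FrameTransport.frameConj F E c v (2 + 2) hJ₂D (antidiagonal_over_eq_map F E 2) Q hQ (toLocalFour F E c v (weylTwo (UnitaryGroup.LocalRing E v) (UnitaryGroup.conjLocal E c v))) * 1) = Φ 1 →
      Integrable (fun x : v.adicCompletion F => (((ψ (x * τ) : Circle) : ℂ)) * Φ (FrameTransport.frameConj F E c v (2 + 2) hJ₂D (antidiagonal_over_eq_map F E 2) Q hQ (toLocalFour F E c v (weylTwo (UnitaryGroup.LocalRing E v) (UnitaryGroup.conjLocal E c v))) * FrameTransport.frameConj F E c v (2 + 2) hJ₂D (antidiagonal_over_eq_map F E 2) Q hQ (toLocalFour F E c v (uLongTwo (UnitaryGroup.LocalRing E v) (UnitaryGroup.conjLocal E c v) (UnitaryGroup.toLocalRing E v x * algebraMap E (UnitaryGroup.LocalRing E v) δ) (conjLocal_coord F E c hcδ v x))) * 1)) μF ∧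
        ∫ x, (((ψ (x * τ) : Circle) : ℂ)) * Φ (FrameTransport.frameConj F E c v (2 + 2) hJ₂D (antidiagonal_over_eq_map F E 2) Q hQ (toLocalFour F E c v (weylTwo (UnitaryGroup.LocalRing E v) (UnitaryGroup.conjLocal E c v))) * FrameTransport.frameConj F E c v (2 + 2) hJ₂D (antidiagonal_over_eq_map F E 2) Q hQ (toLocalFour F E c v (uLongTwo (UnitaryGroup.LocalRing E v) (UnitaryGroup.conjLocal E c v) (UnitaryGroup.toLocalRing E v x * algebraMap E (UnitaryGroup.LocalRing E v) δ) (conjLocal_coord F E c hcδ v x))) * 1) ∂μF = (μF.real (primePowBall (v.adicCompletion F) 0) : ℂ) *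
          (1 + (localSiegelCharacter F E c v 2 χv s (FrameTransport.frameConj F E c v (2 + 2) hJ₂D (antidiagonal_over_eq_map F E 2) Q hQ (toLocalFour F E c v (torusElt (UnitaryGroup.LocalRing E v) (UnitaryGroup.conjLocal E c v) (UnitaryGroup.conjLocal_conjLocal c v hcδ hδ) (-((Units.mk0 δ hδ).map (algebraMap E (UnitaryGroup.LocalRing E v) : E →* UnitaryGroup.LocalRing E v))⁻¹) (1)))) * ((∏ w' : PlacesOver E v, ‖algebraMap E (UnitaryGroup.LocalRing E v) δ w'‖ : ℝ) : ℂ)) *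
            ((∑ k ∈ Finset.range M, (unramValue F v (chiF F E v χv) * (residueFieldCard (v.adicCompletion F) : ℂ) ^ (1 - 2 * s)) ^ (k + 1)) -
              (residueFieldCard (v.adicCompletion F) : ℂ)⁻¹ *
                ∑ k ∈ Finset.range (M + 1), (unramValue F v (chiF F E v χv) * (residueFieldCard (v.adicCompletion F) : ℂ) ^ (1 - 2 * s)) ^ (k + 1))) * Φ 1 := by
    intro Φ hΦK hrel hw₀
    have hmu : ∀ t ∈ primePowBall (v.adicCompletion F) 0, (1 : UnitaryGroup.localPi E c (2 + 2) J₂D v)⁻¹ * FrameTransport.frameConj F E c v (2 + 2) hJ₂D (antidiagonal_over_eq_map F E 2) Q hQ (toLocalFour F E c v (uLongTwo (UnitaryGroup.LocalRing E v) (UnitaryGroup.conjLocal E c v) (UnitaryGroup.toLocalRing E v t * algebraMap E (UnitaryGroup.LocalRing E v) δ) (conjLocal_coord F E c hcδ v t))) * 1 ∈ UnitaryGroup.localInt E c (2 + 2) J₂D v :=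
      fun t ht => by rw [inv_one, one_mul, mul_one]; exact hKu t ht
    have hmū : ∀ t ∈ primePowBall (v.adicCompletion F) 0, (1 : UnitaryGroup.localPi E c (2 + 2) J₂D v)⁻¹ * (FrameTransport.frameConj F E c v (2 + 2) hJ₂D (antidiagonal_over_eq_map F E 2) Q hQ (toLocalFour F E c v (weylTwo (UnitaryGroup.LocalRing E v) (UnitaryGroup.conjLocal E c v))) * FrameTransport.frameConj F E c v (2 + 2) hJ₂D (antidiagonal_over_eq_map F E 2) Q hQ (toLocalFour F E c v (uLongTwo (UnitaryGroup.LocalRing E v) (UnitaryGroup.conjLocal E c v) (UnitaryGroup.toLocalRing E v t * algebraMap E (UnitaryGroup.LocalRing E v) δ⁻¹) (conjLocal_coord_inv F E c hcδ v t))) * FrameTransport.frameConj F E c v (2 + 2) hJ₂D (antidiagonal_over_eq_map F E 2) Q hQ (toLocalFour F E c v (weylTwo (UnitaryGroup.LocalRing E v) (UnitaryGroup.conjLocal E c v)))) * 1 ∈ UnitaryGroup.localInt E c (2 + 2) J₂D v :=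
      fun t ht => by
        rw [inv_one, one_mul, mul_one]
        exact (UnitaryGroup.localInt E c (2 + 2) J₂D v).mul_mem ((UnitaryGroup.localInt E c (2 + 2) J₂D v).mul_mem hKw₂ (hKū t ht)) hKw₂
    exact integrable_and_integral_addChar_mul_apply_eq μF hΦK
      (u := fun x => FrameTransport.frameConj F E c v (2 + 2) hJ₂D (antidiagonal_over_eq_map F E 2) Q hQ (toLocalFour F E c v (uLongTwo (UnitaryGroup.LocalRing E v) (UnitaryGroup.conjLocal E c v) (UnitaryGroup.toLocalRing E v x * algebraMap E (UnitaryGroup.LocalRing E v) δ) (conjLocal_coord F E c hcδ v x))))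
      (ū := fun t => FrameTransport.frameConj F E c v (2 + 2) hJ₂D (antidiagonal_over_eq_map F E 2) Q hQ (toLocalFour F E c v (weylTwo (UnitaryGroup.LocalRing E v) (UnitaryGroup.conjLocal E c v))) * FrameTransport.frameConj F E c v (2 + 2) hJ₂D (antidiagonal_over_eq_map F E 2) Q hQ (toLocalFour F E c v (uLongTwo (UnitaryGroup.LocalRing E v) (UnitaryGroup.conjLocal E c v) (UnitaryGroup.toLocalRing E v t * algebraMap E (UnitaryGroup.LocalRing E v) δ⁻¹) (conjLocal_coord_inv F E c hcδ v t))) * FrameTransport.frameConj F E c v (2 + 2) hJ₂D (antidiagonal_over_eq_map F E 2) Q hQ (toLocalFour F E c v (weylTwo (UnitaryGroup.LocalRing E v) (UnitaryGroup.conjLocal E c v))))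
      (frameConj_uLongTwo_coord_add F E c hcδ v hJ₂D Q hQ) (FrameTransport.frameConj F E c v (2 + 2) hJ₂D (antidiagonal_over_eq_map F E 2) Q hQ (toLocalFour F E c v (weylTwo (UnitaryGroup.LocalRing E v) (UnitaryGroup.conjLocal E c v)))) (chiF F E v χv) (norm_chiF_eq_one (F := F) (E := E) hχu)
      (isUnramifiedChar_chiF F E v χv hχ') (2 * s) _ heC (fun x g => by simpa only using hrel x g) 1 hmu hmū hw₀ hψ h0 hM hM'
  -- ★ p862724 at `K₀ := K_v`, `h := 1`
  have h := K2LiuRankOneSingularLocalValue.integral_addChar_mul_eq_of_spherical_of_forall_eq F E c hcδ hδ hd v hT₂ hJ₂D D Dinv hDD Q hQm hQ μF e he headd νN χv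
    hχu (UnitaryGroup.localInt E c (2 + 2) J₂D v) (UnitaryGroup.isOpen_localInt E c (2 + 2) J₂D v) hs hf.isLocalSiegelSection hf.isSmooth hfK w hw A hA hKw₂
    (frameConj_leviElt_partialWeyl_mem_localInt F E c hcδ hδ v hJ₂D D Dinv hDD Q hQm hQ h2 hDw hDiw w A hA) hKu hKū
    (fun ζ hζ => frameConj_uMinus_single_mem_localInt F E c hcδ hδ v hJ₂D D Dinv hDD Q hQm hQ h2 hDw hDiw w ζ hζ) 1 (one_mem _) ψ hψ τ _ htw
  rw [hf.apply_one, mul_one, box_eq_setOf_mem_localInt_of_forall_eq F E c hcδ hδ v hJ₂D D Dinv hDD hDD' Q hQm hQ h2 hδv hDw hDiw w hw,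
    localSiegelCharacter_weylDelta_mul_frameConj_weylSiegel_eq_one F E c v hJ₂D D Dinv hDD Q hQm hQ χv hχ (valuation_det_eq_one_of_integral F E v hDD hDw hDiw) s,
    localSiegelCharacter_torusElt_one_negInvDelta_eq_one F E c hcδ hδ v hJ₂D D Dinv hDD Q hQm hQ χv hχ hδv s, chi_neg_one_eq_one F E v χv hχ w,
    localSiegelCharacter_torusElt_negInvDelta_one_mul_prod_norm_eq_one F E c hcδ hδ v hJ₂D D Dinv hDD Q hQm hQ χv hχ hδv s, one_mul] at h
  simp only [mul_one, one_mul] at h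
  rw [h, one_add_eq_lFactor_div_lFactor (chiF F E v χv) (norm_chiF_eq_one (F := F) (E := E) hχu) (by simp; linarith : 1 < (2 * s + 2).re),
    one_add_eq_lFactor_div_lFactor (chiNorm F E c v χv w) (norm_chiNorm_eq_one (F := F) (E := E) (c := c) hχu w) (by simp; linarith : 1 < (2 * s + 1).re),
    one_add_shellSum_eq_lFactor_inv_mul_sum F v (chiF F E v χv) (2 * s) M]
  -- the ratios in ★ T1 `lF`∕`lEN` letters (one place above `v`)
  have hL1 : lFactor F v (chiF F E v χv) (2 * s + 2 - 1) = lF F E v χv (2 * s + 1) := by rw [lF]; congr 1; ring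
  have hL1' : lFactor F v (chiF F E v χv) (2 * s + 2) = lF F E v χv (2 * s + 2) := rfl
  have hL2 : lFactor E w.1 (chiNorm F E c v χv w) (2 * s + 1 - 1) = lEN F E c v χv (2 * s) := by
    rw [lEN, Fintype.prod_eq_single w fun w' hw' => absurd (hw w') hw']; congr 1; ring
  have hL2' : lFactor E w.1 (chiNorm F E c v χv w) (2 * s + 1) = lEN F E c v χv (2 * s + 1) := by
    rw [lEN, Fintype.prod_eq_single w fun w' hw' => absurd (hw w') hw']
  have hL3 : lFactor F v (chiF F E v χv) (2 * s) = lF F E v χv (2 * s) := rfl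
  rw [hL1, hL1', hL2, hL2', hL3]


/-! ## §2 Split place -/

include hd hT₂ hDD hDD' hQm he headd h2 hδv hDw hDiw hχu hχ hψ h0 hM hM' in
set_option maxHeartbeats 400000 in -- as §1 (the binder telescope of the chain)
/-- **THE TWISTED SIEGEL INTEGRAL OF THE SPHERICAL SECTION, SPLIT GOOD PLACE.**  `w₁ ≠ w₂` the places of `E` above `v`; `|2|_{wᵢ} = |δ|_{wᵢ} = 1`, `χ_{wᵢ}` unramified
and unitary, the frame integral; `ψ` of conductor `𝒪_v`, `τ ∈ 𝔭^M ∖ 𝔭^{M+1}`.  Then for every spherical section `φ°` of `I_v(s, χ_v)`, `1 < re s`, every Haar `νN`: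
**`∫ ψ((e⁻¹u)₁·τ) φ°(w_Δ u) dνN(u) = νN{u | ↑u ∈ K_v} · [lF(2s+1)∕lF(2s+2)] · [lEN(2s)∕lEN(2s+1)] · lF(2s)⁻¹ · Σ_{k≤M} (unramValue χ_F · q_v^{1−2s})^k`**
(★ (K1a-2c) at `K₀ := K_v`, `h := 1`; letters ★ FILE B part 1 §2; box ★ part 1 §3; the five unit scalars ★ FILE A §2; `htw` ★ p862774 §3; `lEN = L_{w₁}·L_{w₂}`).
[cite: Casselman1980, §3 Thm. 3.1] [cite: KudlaRallis1994, §2] [cite: HarrisKudlaSweet1996, §6 (6.16)] [cite: Tate1950, §2.5] -/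
theorem integral_addChar_mul_weylDelta_eq_of_isSphericalSection_of_pair
    {s : ℂ} (hs : 1 < s.re) {f : UnitaryGroup.localPi E c (2 + 2) J₂D v → ℂ} (hf : IsSphericalSection F E c hcδ hδ hd v 2 hT₂ hJ₂D χv s f)
    (w₁ w₂ : PlacesOver E v) (hne : w₁ ≠ w₂) (hw : ∀ w' : PlacesOver E v, w' = w₁ ∨ w' = w₂) :
    ∫ u, (((ψ ((e.symm u).1 * τ) : Circle) : ℂ)) * f (weylDelta F E c v 2 hJ₂D (T₀ := T₂) * (u : UnitaryGroup.localPi E c (2 + 2) J₂D v)) ∂νN =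
      (νN.real {u : unipDeltaLocal F E c v 2 (JD := J₂D) | (u : UnitaryGroup.localPi E c (2 + 2) J₂D v) ∈ UnitaryGroup.localInt E c (2 + 2) J₂D v} : ℂ) *
        ((lF F E v χv (2 * s + 1) / lF F E v χv (2 * s + 2)) * (lEN F E c v χv (2 * s) / lEN F E c v χv (2 * s + 1)) *
          ((lF F E v χv (2 * s))⁻¹ *
            ∑ k ∈ Finset.range (M + 1), (unramValue F v (chiF F E v χv) * (residueFieldCard (v.adicCompletion F) : ℂ) ^ (1 - 2 * s)) ^ k)) := by
  borelize (v.adicCompletion F)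
  obtain ⟨μF, hμF⟩ : ∃ μ : Measure (v.adicCompletion F), μ.IsAddHaarMeasure := ⟨Measure.addHaar, inferInstance⟩
  obtain ⟨A₁, hA₁⟩ := exists_partialWeylGL F E v w₁
  obtain ⟨A₂, hA₂⟩ := exists_partialWeylGL F E v w₂
  have hfK : ∀ g, ∀ k ∈ UnitaryGroup.localInt E c (2 + 2) J₂D v, f (g * k) = f g := fun g k hk => hf.apply_mul_of_mem_localInt hk g
  have hχ' : ∀ (w' : PlacesOver E v) (u : (w'.1.adicCompletion E)ˣ), Valued.v (u : w'.1.adicCompletion E) = 1 → χv w' u = 1 :=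
    fun w' u hu => hχ w' u ((valuation_eq_one_iff_valued E w'.1 _).2 hu)
  have heC : 1 < (2 * s).re := by simp; linarith
  -- the letters of `K_v` at integral points (★ FILE B part 1 §2)
  have hKw₂ := frameConj_weylTwo_mem_localInt F E c v hJ₂D D Dinv hDD Q hQm hQ h2 hDw hDiw
  have hKu : ∀ t ∈ primePowBall (v.adicCompletion F) 0, FrameTransport.frameConj F E c v (2 + 2) hJ₂D (antidiagonal_over_eq_map F E 2) Q hQ (toLocalFour F E c v (uLongTwo (UnitaryGroup.LocalRing E v) (UnitaryGroup.conjLocal E c v) (UnitaryGroup.toLocalRing E v t * algebraMap E (UnitaryGroup.LocalRing E v) δ) (conjLocal_coord F E c hcδ v t))) ∈ UnitaryGroup.localInt E c (2 + 2) J₂D v :=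
    fun t ht => frameConj_uLongTwo_coord_mem_localInt F E c hcδ v hJ₂D D Dinv hDD Q hQm hQ h2 hδv hDw hDiw t ht
  have hKū : ∀ t ∈ primePowBall (v.adicCompletion F) 0, FrameTransport.frameConj F E c v (2 + 2) hJ₂D (antidiagonal_over_eq_map F E 2) Q hQ (toLocalFour F E c v (uLongTwo (UnitaryGroup.LocalRing E v) (UnitaryGroup.conjLocal E c v) (UnitaryGroup.toLocalRing E v t * algebraMap E (UnitaryGroup.LocalRing E v) δ⁻¹) (conjLocal_coord_inv F E c hcδ v t))) ∈ UnitaryGroup.localInt E c (2 + 2) J₂D v :=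
    fun t ht => frameConj_uLongTwo_coord_inv_mem_localInt F E c hcδ v hJ₂D D Dinv hDD Q hQm hQ h2 hδv hDw hDiw t ht
  -- the twisted rank-one stage `htw` (★ p862774 §3, as in §1)
  have htw : ∀ Φ : UnitaryGroup.localPi E c (2 + 2) J₂D v → ℂ, (∀ g, ∀ k ∈ UnitaryGroup.localInt E c (2 + 2) J₂D v, Φ (g * k) = Φ g) →
      (∀ (x : (v.adicCompletion F)ˣ) (g : UnitaryGroup.localPi E c (2 + 2) J₂D v),
        Φ (FrameTransport.frameConj F E c v (2 + 2) hJ₂D (antidiagonal_over_eq_map F E 2) Q hQ (toLocalFour F E c v (weylTwo (UnitaryGroup.LocalRing E v) (UnitaryGroup.conjLocal E c v))) * FrameTransport.frameConj F E c v (2 + 2) hJ₂D (antidiagonal_over_eq_map F E 2) Q hQ (toLocalFour F E c v (uLongTwo (UnitaryGroup.LocalRing E v) (UnitaryGroup.conjLocal E c v) (UnitaryGroup.toLocalRing E v (x : v.adicCompletion F) * algebraMap E (UnitaryGroup.LocalRing E v) δ) (conjLocal_coord F E c hcδ v (x : v.adicCompletion F)))) * g) =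
          (localSiegelCharacter F E c v 2 χv s (FrameTransport.frameConj F E c v (2 + 2) hJ₂D (antidiagonal_over_eq_map F E 2) Q hQ (toLocalFour F E c v (torusElt (UnitaryGroup.LocalRing E v) (UnitaryGroup.conjLocal E c v) (UnitaryGroup.conjLocal_conjLocal c v hcδ hδ) (-((Units.mk0 δ hδ).map (algebraMap E (UnitaryGroup.LocalRing E v) : E →* UnitaryGroup.LocalRing E v))⁻¹) (1)))) * ((∏ w' : PlacesOver E v, ‖algebraMap E (UnitaryGroup.LocalRing E v) δ w'‖ : ℝ) : ℂ)) * ((((chiF F E v χv) x)⁻¹ : ℂˣ) : ℂ) * ((normAbs (v.adicCompletion F) (x : v.adicCompletion F) : ℝ) : ℂ) ^ (-(2 * s)) *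
            Φ (FrameTransport.frameConj F E c v (2 + 2) hJ₂D (antidiagonal_over_eq_map F E 2) Q hQ (toLocalFour F E c v (weylTwo (UnitaryGroup.LocalRing E v) (UnitaryGroup.conjLocal E c v))) * FrameTransport.frameConj F E c v (2 + 2) hJ₂D (antidiagonal_over_eq_map F E 2) Q hQ (toLocalFour F E c v (uLongTwo (UnitaryGroup.LocalRing E v) (UnitaryGroup.conjLocal E c v) (UnitaryGroup.toLocalRing E v ((x⁻¹ : (v.adicCompletion F)ˣ) : v.adicCompletion F) * algebraMap E (UnitaryGroup.LocalRing E v) δ⁻¹) (conjLocal_coord_inv F E c hcδ v ((x⁻¹ : (v.adicCompletion F)ˣ) : v.adicCompletion F)))) * FrameTransport.frameConj F E c v (2 + 2) hJ₂D (antidiagonal_over_eq_map F E 2) Q hQ (toLocalFour F E c v (weylTwo (UnitaryGroup.LocalRing E v) (UnitaryGroup.conjLocal E c v))) * g)) →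
      Φ (FrameTransport.frameConj F E c v (2 + 2) hJ₂D (antidiagonal_over_eq_map F E 2) Q hQ (toLocalFour F E c v (weylTwo (UnitaryGroup.LocalRing E v) (UnitaryGroup.conjLocal E c v))) * 1) = Φ 1 →
      Integrable (fun x : v.adicCompletion F => (((ψ (x * τ) : Circle) : ℂ)) * Φ (FrameTransport.frameConj F E c v (2 + 2) hJ₂D (antidiagonal_over_eq_map F E 2) Q hQ (toLocalFour F E c v (weylTwo (UnitaryGroup.LocalRing E v) (UnitaryGroup.conjLocal E c v))) * FrameTransport.frameConj F E c v (2 + 2) hJ₂D (antidiagonal_over_eq_map F E 2) Q hQ (toLocalFour F E c v (uLongTwo (UnitaryGroup.LocalRing E v) (UnitaryGroup.conjLocal E c v) (UnitaryGroup.toLocalRing E v x * algebraMap E (UnitaryGroup.LocalRing E v) δ) (conjLocal_coord F E c hcδ v x))) * 1)) μF ∧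
        ∫ x, (((ψ (x * τ) : Circle) : ℂ)) * Φ (FrameTransport.frameConj F E c v (2 + 2) hJ₂D (antidiagonal_over_eq_map F E 2) Q hQ (toLocalFour F E c v (weylTwo (UnitaryGroup.LocalRing E v) (UnitaryGroup.conjLocal E c v))) * FrameTransport.frameConj F E c v (2 + 2) hJ₂D (antidiagonal_over_eq_map F E 2) Q hQ (toLocalFour F E c v (uLongTwo (UnitaryGroup.LocalRing E v) (UnitaryGroup.conjLocal E c v) (UnitaryGroup.toLocalRing E v x * algebraMap E (UnitaryGroup.LocalRing E v) δ) (conjLocal_coord F E c hcδ v x))) * 1) ∂μF = (μF.real (primePowBall (v.adicCompletion F) 0) : ℂ) *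
          (1 + (localSiegelCharacter F E c v 2 χv s (FrameTransport.frameConj F E c v (2 + 2) hJ₂D (antidiagonal_over_eq_map F E 2) Q hQ (toLocalFour F E c v (torusElt (UnitaryGroup.LocalRing E v) (UnitaryGroup.conjLocal E c v) (UnitaryGroup.conjLocal_conjLocal c v hcδ hδ) (-((Units.mk0 δ hδ).map (algebraMap E (UnitaryGroup.LocalRing E v) : E →* UnitaryGroup.LocalRing E v))⁻¹) (1)))) * ((∏ w' : PlacesOver E v, ‖algebraMap E (UnitaryGroup.LocalRing E v) δ w'‖ : ℝ) : ℂ)) *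
            ((∑ k ∈ Finset.range M, (unramValue F v (chiF F E v χv) * (residueFieldCard (v.adicCompletion F) : ℂ) ^ (1 - 2 * s)) ^ (k + 1)) -
              (residueFieldCard (v.adicCompletion F) : ℂ)⁻¹ *
                ∑ k ∈ Finset.range (M + 1), (unramValue F v (chiF F E v χv) * (residueFieldCard (v.adicCompletion F) : ℂ) ^ (1 - 2 * s)) ^ (k + 1))) * Φ 1 := by
    intro Φ hΦK hrel hw₀
    have hmu : ∀ t ∈ primePowBall (v.adicCompletion F) 0, (1 : UnitaryGroup.localPi E c (2 + 2) J₂D v)⁻¹ * FrameTransport.frameConj F E c v (2 + 2) hJ₂D (antidiagonal_over_eq_map F E 2) Q hQ (toLocalFour F E c v (uLongTwo (UnitaryGroup.LocalRing E v) (UnitaryGroup.conjLocal E c v) (UnitaryGroup.toLocalRing E v t * algebraMap E (UnitaryGroup.LocalRing E v) δ) (conjLocal_coord F E c hcδ v t))) * 1 ∈ UnitaryGroup.localInt E c (2 + 2) J₂D v :=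
      fun t ht => by rw [inv_one, one_mul, mul_one]; exact hKu t ht
    have hmū : ∀ t ∈ primePowBall (v.adicCompletion F) 0, (1 : UnitaryGroup.localPi E c (2 + 2) J₂D v)⁻¹ * (FrameTransport.frameConj F E c v (2 + 2) hJ₂D (antidiagonal_over_eq_map F E 2) Q hQ (toLocalFour F E c v (weylTwo (UnitaryGroup.LocalRing E v) (UnitaryGroup.conjLocal E c v))) * FrameTransport.frameConj F E c v (2 + 2) hJ₂D (antidiagonal_over_eq_map F E 2) Q hQ (toLocalFour F E c v (uLongTwo (UnitaryGroup.LocalRing E v) (UnitaryGroup.conjLocal E c v) (UnitaryGroup.toLocalRing E v t * algebraMap E (UnitaryGroup.LocalRing E v) δ⁻¹) (conjLocal_coord_inv F E c hcδ v t))) * FrameTransport.frameConj F E c v (2 + 2) hJ₂D (antidiagonal_over_eq_map F E 2) Q hQ (toLocalFour F E c v (weylTwo (UnitaryGroup.LocalRing E v) (UnitaryGroup.conjLocal E c v)))) * 1 ∈ UnitaryGroup.localInt E c (2 + 2) J₂D v :=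
      fun t ht => by
        rw [inv_one, one_mul, mul_one]
        exact (UnitaryGroup.localInt E c (2 + 2) J₂D v).mul_mem ((UnitaryGroup.localInt E c (2 + 2) J₂D v).mul_mem hKw₂ (hKū t ht)) hKw₂
    exact integrable_and_integral_addChar_mul_apply_eq μF hΦK
      (u := fun x => FrameTransport.frameConj F E c v (2 + 2) hJ₂D (antidiagonal_over_eq_map F E 2) Q hQ (toLocalFour F E c v (uLongTwo (UnitaryGroup.LocalRing E v) (UnitaryGroup.conjLocal E c v) (UnitaryGroup.toLocalRing E v x * algebraMap E (UnitaryGroup.LocalRing E v) δ) (conjLocal_coord F E c hcδ v x))))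
      (ū := fun t => FrameTransport.frameConj F E c v (2 + 2) hJ₂D (antidiagonal_over_eq_map F E 2) Q hQ (toLocalFour F E c v (weylTwo (UnitaryGroup.LocalRing E v) (UnitaryGroup.conjLocal E c v))) * FrameTransport.frameConj F E c v (2 + 2) hJ₂D (antidiagonal_over_eq_map F E 2) Q hQ (toLocalFour F E c v (uLongTwo (UnitaryGroup.LocalRing E v) (UnitaryGroup.conjLocal E c v) (UnitaryGroup.toLocalRing E v t * algebraMap E (UnitaryGroup.LocalRing E v) δ⁻¹) (conjLocal_coord_inv F E c hcδ v t))) * FrameTransport.frameConj F E c v (2 + 2) hJ₂D (antidiagonal_over_eq_map F E 2) Q hQ (toLocalFour F E c v (weylTwo (UnitaryGroup.LocalRing E v) (UnitaryGroup.conjLocal E c v))))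
      (frameConj_uLongTwo_coord_add F E c hcδ v hJ₂D Q hQ) (FrameTransport.frameConj F E c v (2 + 2) hJ₂D (antidiagonal_over_eq_map F E 2) Q hQ (toLocalFour F E c v (weylTwo (UnitaryGroup.LocalRing E v) (UnitaryGroup.conjLocal E c v)))) (chiF F E v χv) (norm_chiF_eq_one (F := F) (E := E) hχu)
      (isUnramifiedChar_chiF F E v χv hχ') (2 * s) _ heC (fun x g => by simpa only using hrel x g) 1 hmu hmū hw₀ hψ h0 hM hM'
  -- ★ (K1a-2c) at `K₀ := K_v`, `h := 1`
  have h := K2LiuRankOneSingularLocalValueSplit.integral_addChar_mul_eq_of_spherical_of_pair F E c hcδ hδ hd v hT₂ hJ₂D D Dinv hDD Q hQm hQ μF e he headd νN χv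
    hχu (UnitaryGroup.localInt E c (2 + 2) J₂D v) (UnitaryGroup.isOpen_localInt E c (2 + 2) J₂D v) hs hf.isLocalSiegelSection hf.isSmooth hfK w₁ w₂ hne hw A₁ hA₁ A₂ hA₂ hKw₂
    (frameConj_leviElt_partialWeyl_mem_localInt F E c hcδ hδ v hJ₂D D Dinv hDD Q hQm hQ h2 hDw hDiw w₁ A₁ hA₁)
    (frameConj_leviElt_partialWeyl_mem_localInt F E c hcδ hδ v hJ₂D D Dinv hDD Q hQm hQ h2 hDw hDiw w₂ A₂ hA₂) hKu hKū
    (fun ζ hζ => frameConj_uMinus_single_mem_localInt F E c hcδ hδ v hJ₂D D Dinv hDD Q hQm hQ h2 hDw hDiw w₁ ζ hζ)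
    (fun ζ hζ => frameConj_uMinus_single_mem_localInt F E c hcδ hδ v hJ₂D D Dinv hDD Q hQm hQ h2 hDw hDiw w₂ ζ hζ) 1 (one_mem _) ψ hψ τ _ htw
  rw [hf.apply_one, mul_one, box_eq_setOf_mem_localInt_of_pair F E c hcδ hδ v hJ₂D D Dinv hDD hDD' Q hQm hQ h2 hδv hDw hDiw w₁ w₂ hne hw,
    localSiegelCharacter_weylDelta_mul_frameConj_weylSiegel_eq_one F E c v hJ₂D D Dinv hDD Q hQm hQ χv hχ (valuation_det_eq_one_of_integral F E v hDD hDw hDiw) s,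
    localSiegelCharacter_torusElt_one_negInvDelta_eq_one F E c hcδ hδ v hJ₂D D Dinv hDD Q hQm hQ χv hχ hδv s, chi_neg_one_eq_one F E v χv hχ w₁,
    chi_neg_one_eq_one F E v χv hχ w₂,
    localSiegelCharacter_torusElt_negInvDelta_one_mul_prod_norm_eq_one F E c hcδ hδ v hJ₂D D Dinv hDD Q hQm hQ χv hχ hδv s, one_mul] at h
  simp only [mul_one, one_mul] at h
  rw [h, one_add_eq_lFactor_div_lFactor (chiF F E v χv) (norm_chiF_eq_one (F := F) (E := E) hχu) (by simp; linarith : 1 < (2 * s + 2).re),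
    one_add_eq_lFactor_div_lFactor (chiNorm F E c v χv w₁) (norm_chiNorm_eq_one (F := F) (E := E) (c := c) hχu w₁) (by simp; linarith : 1 < (2 * s + 1).re),
    one_add_eq_lFactor_div_lFactor (chiNorm F E c v χv w₂) (norm_chiNorm_eq_one (F := F) (E := E) (c := c) hχu w₂) (by simp; linarith : 1 < (2 * s + 1).re),
    one_add_shellSum_eq_lFactor_inv_mul_sum F v (chiF F E v χv) (2 * s) M]
  -- the ratios in ★ T1 `lF`∕`lEN` letters (`lEN = L_{w₁} · L_{w₂}`)
  have hlF : ∀ z : ℂ, lF F E v χv z = lFactor F v (chiF F E v χv) z := fun z => rfl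
  have hlEN : ∀ z : ℂ, lEN F E c v χv z = lFactor E w₁.1 (chiNorm F E c v χv w₁) z * lFactor E w₂.1 (chiNorm F E c v χv w₂) z := fun z => by
    rw [lEN, Fintype.prod_eq_mul w₁ w₂ hne fun w' hw'' => ((hw w').elim (fun h' => absurd h' hw''.1) fun h' => absurd h' hw''.2)]
  have h21 : (2 * s + 2 - 1 : ℂ) = 2 * s + 1 := by ring
  have h11 : (2 * s + 1 - 1 : ℂ) = 2 * s := by ring
  rw [h21, h11, hlF, hlF, hlF, hlEN, hlEN]
  ring

/-! ## §3 Every good place -/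

include hd hT₂ hDD hDD' hQm he headd h2 hδv hDw hDiw hχu hχ hψ h0 hM hM' in
/-- **THE TWISTED SIEGEL INTEGRAL OF THE SPHERICAL SECTION AT A GOOD PLACE** (both place types, ★ `placesOver_cases'`).  Let `|2|_w = |δ|_w = 1` and `χ_w` be unramified and
unitary at every `w ∣ v`, the frame `D`, `D⁻¹` integral at every `w ∣ v`, `ψ` a continuous additive character of `F_v` of conductor `𝒪_v` and `τ ∈ 𝔭^M ∖ 𝔭^{M+1}`.  Then for
every spherical section `φ°` of `I_v(s, χ_v)` (★ D10 `IsSphericalSection`), every `1 < re s` and every Haar measure `νN` on `N_Δ(F_v)`: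
**`∫ ψ((e⁻¹u)₁·τ) φ°(w_Δ u) dνN(u) = νN{u | ↑u ∈ K_v} · [lF(2s+1)∕lF(2s+2)] · [lEN(2s)∕lEN(2s+1)] · lF(2s)⁻¹ · Σ_{k≤M} (unramValue χ_F · q_v^{1−2s})^k`** — the `hGK` letter
of ★ p862811 (K1a-2d) ED. 1 §2 at `R vol := vol · (…)`, for the generic doubled datum.
[cite: Casselman1980, §3 Thm. 3.1] [cite: KudlaRallis1994, §2] [cite: Shimura1997, §18.4] [cite: HarrisKudlaSweet1996, §6 (6.14)–(6.16)] [cite: Tate1950, §2.5] -/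
theorem integral_addChar_mul_weylDelta_eq_of_isSphericalSection
    {s : ℂ} (hs : 1 < s.re) {f : UnitaryGroup.localPi E c (2 + 2) J₂D v → ℂ} (hf : IsSphericalSection F E c hcδ hδ hd v 2 hT₂ hJ₂D χv s f) :
    ∫ u, (((ψ ((e.symm u).1 * τ) : Circle) : ℂ)) * f (weylDelta F E c v 2 hJ₂D (T₀ := T₂) * (u : UnitaryGroup.localPi E c (2 + 2) J₂D v)) ∂νN =
      (νN.real {u : unipDeltaLocal F E c v 2 (JD := J₂D) | (u : UnitaryGroup.localPi E c (2 + 2) J₂D v) ∈ UnitaryGroup.localInt E c (2 + 2) J₂D v} : ℂ) *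
        ((lF F E v χv (2 * s + 1) / lF F E v χv (2 * s + 2)) * (lEN F E c v χv (2 * s) / lEN F E c v χv (2 * s + 1)) *
          ((lF F E v χv (2 * s))⁻¹ *
            ∑ k ∈ Finset.range (M + 1), (unramValue F v (chiF F E v χv) * (residueFieldCard (v.adicCompletion F) : ℂ) ^ (1 - 2 * s)) ^ k)) := by
  rcases placesOver_cases' F E c v hcδ hδ with ⟨w, hw⟩ | ⟨w₁, w₂, hne, hw⟩
  · exact integral_addChar_mul_weylDelta_eq_of_isSphericalSection_of_forall_eq F E c hcδ hδ hd v hT₂ hJ₂D D Dinv hDD hDD' Q hQm hQ h2 hδv hDw hDiw e he headd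
      νN χv hχu hχ hψ h0 hM hM' hs hf w hw
  · exact integral_addChar_mul_weylDelta_eq_of_isSphericalSection_of_pair F E c hcδ hδ hd v hT₂ hJ₂D D Dinv hDD hDD' Q hQm hQ h2 hδv hDw hDiw e he headd νN χv
      hχu hχ hψ h0 hM hM' hs hf w₁ w₂ hne hw

include hd hT₂ hDD hDD' hQm he headd hDw hDiw hχu hψ h0 hM hM' in
/-- **THE SAME AT A GOOD PLACE IN THE SENSE OF ★ Lit `LocalSplitting.IsGoodPlace`** (`|2|_w = 1`, `|δ|_w = 1`, `χ_w` unramified read off its fields `two`, `delta`, `chi`;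
the frame integrality stays a hypothesis; the conductor of `ψ` stays a hypothesis — for `ψ := adeleAddCharAt F v` it is the field `psi`).
[cite: GelbartRogawski1991, §3.1 (3.1.3)] [cite: Casselman1980, §3 Thm. 3.1] [cite: KudlaRallis1994, §2] [cite: HarrisKudlaSweet1996, §6 (6.14)–(6.16)] -/
theorem integral_addChar_mul_weylDelta_eq_of_isSphericalSection_of_isGoodPlace (hv : IsGoodPlace F E δ v 2 T₂ χv)
    {s : ℂ} (hs : 1 < s.re) {f : UnitaryGroup.localPi E c (2 + 2) J₂D v → ℂ} (hf : IsSphericalSection F E c hcδ hδ hd v 2 hT₂ hJ₂D χv s f) :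
    ∫ u, (((ψ ((e.symm u).1 * τ) : Circle) : ℂ)) * f (weylDelta F E c v 2 hJ₂D (T₀ := T₂) * (u : UnitaryGroup.localPi E c (2 + 2) J₂D v)) ∂νN =
      (νN.real {u : unipDeltaLocal F E c v 2 (JD := J₂D) | (u : UnitaryGroup.localPi E c (2 + 2) J₂D v) ∈ UnitaryGroup.localInt E c (2 + 2) J₂D v} : ℂ) *
        ((lF F E v χv (2 * s + 1) / lF F E v χv (2 * s + 2)) * (lEN F E c v χv (2 * s) / lEN F E c v χv (2 * s + 1)) *
          ((lF F E v χv (2 * s))⁻¹ *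
            ∑ k ∈ Finset.range (M + 1), (unramValue F v (chiF F E v χv) * (residueFieldCard (v.adicCompletion F) : ℂ) ^ (1 - 2 * s)) ^ k)) :=
  integral_addChar_mul_weylDelta_eq_of_isSphericalSection F E c hcδ hδ hd v hT₂ hJ₂D D Dinv hDD hDD' Q hQm hQ hv.two hv.delta hDw hDiw e he headd νN χv hχu hv.chi
    hψ h0 hM hM' hs hf

end Summit.HodgeConjecture.HodgeConjecture.Cruxes.HLiu418.K2LiuRankOneSingularLocalValueGoodPlace

end
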